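import Literature.NumberTheory.Sieve.Maynard2016Lemma93MainSkeleton
import HarnessLib

/-!
# Maynard 2016, proof of Lemma 9.3 — the `e_m`-dependence of the Euler product (display (9.28))

Sources: J. Maynard, *Dense clusters of primes in subsets*, Compositio Math. 152 (2016) 1517–1554 =
arXiv:1405.2593 [Maynard2016DenseClusters], proof of Lemma 9.3, p. 24 (displays (9.27)–(9.28): the sum is
«a product … multiplied by a factor depending only on `e_m`»); K. Ford, B. Green, S. Konyagin, J. Maynard,
T. Tao, *Long gaps between primes*, JAMS 31 (2018) [FordGreenKonyaginMaynardTao2018], §7 (7.8), Thm 6 (7.13).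

In the main term of `FGKMT2018.yVarM_eq_main_add_err` the Euler product `∏_{p ≤ ⌊R⌋} Λ_p` is taken with
`M = ∏ r[m ↦ c]`, which depends on the summation variable `c = e_m`. This file separates that dependence
exactly (display (9.28)): for `r ∈ 𝒟'^{(m)}_k` and admissible `c` (`r[m↦c] ∈ admBox`),

`(1/φ_ω(c)) ∏_{p ≤ ⌊R⌋} Λ_p(∏ r[m↦c]) = (∏_{p ≤ ⌊R⌋} Λ_p(∏ r)) · (∏_{p ∣ c} (p − ω(p))·X_p)⁻¹`,
`X_p = p/(p−1) − 1/(p − ω(p))` (`eulerProd_update_div_phiOmega_eq`):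
for `p ∤ c` the factor does not see `c` (`eulerFactorM_congr_dvd`, `dvd_prod_update_iff`), and for `p ∣ c`
it is `1` on the left (`p ∣ M`) and `X_p` on the right (`eulerFactorM_sPrime_of_dvd`: such `p` have
`p ∤ WB·∏r`, `m ∈ admIdx(p)` and hence `p ∤ a_m`). The weight `(∏_{p∣c}(p − ω(p))X_p)⁻¹` is
`MaynardDense.emWeight M ω c` of `Maynard2016Lemma93EmSummation` (`(p − ω)X_p = (p − ω)p/(p−1) − 1 = emA`,
`sub_mul_emFactor_eq`), so the main term is `(∏r/φ_L)·(∏_{p ≤ ⌊R⌋} Λ_p(∏r))·∑_c emWeight(c)·y_{r[m↦c]}` —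
the input of (9.29).

## References
* J. Maynard, *Dense clusters of primes in subsets*, Compositio Math. 152 (2016), proof of Lemma 9.3
  p. 24, (9.27)–(9.28) [Maynard2016DenseClusters].
* K. Ford, B. Green, S. Konyagin, J. Maynard, T. Tao, *Long gaps between primes*, JAMS 31 (2018), §7 (7.8),
  Thm 6 (7.13) [FordGreenKonyaginMaynardTao2018].
-/

noncomputable section

open Finset
open scoped Nat

namespace Literature.NumberTheory.Sieve

namespace FGKMT2018

variable {k : ℕ}

/-- The Euler factor sees `M` only through `p ∣ M`. [cite: Maynard2016DenseClusters, proof of Lemma 9.3 p. 24, (9.27)] -/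
theorem eulerFactorM_congr_dvd (L : Fin k → ℤ × ℤ) (B : ℕ) (m : Fin k) {M M' : ℕ}
    (wloc : ℕ → Fin k → ℝ) {p : ℕ} (h : p ∣ M ↔ p ∣ M') :
    eulerFactorM L B m M wloc p = eulerFactorM L B m M' wloc p := by
  unfold eulerFactorM; simp only [h]

/-- `Λ_p = 1` for `p ∣ M`. [cite: Maynard2016DenseClusters, proof of Lemma 9.3 p. 24, (9.27)] -/
theorem eulerFactorM_of_dvd (L : Fin k → ℤ × ℤ) (B : ℕ) (m : Fin k) {M : ℕ} (wloc : ℕ → Fin k → ℝ)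
    {p : ℕ} (h : p ∣ M) : eulerFactorM L B m M wloc p = 1 := by
  unfold eulerFactorM; rw [if_neg fun hc => hc.2 h, add_zero]

/-- `∏ r[m↦c] = c·∏ r` for `r_m = 1`. [cite: Maynard2016DenseClusters, proof of Lemma 9.3 p. 24, (9.26)] -/
theorem prod_update_eq_mul {r : Fin k → ℕ} {m : Fin k} (hrm : r m = 1) (c : ℕ) :
    ∏ i, Function.update r m c i = c * ∏ i, r i := by
  have h := prod_update_mul r m c
  rwa [hrm, one_mul] at h

/-- For `r_m = 1` and a prime `p ∤ c`: `p ∣ ∏ r[m↦c] ↔ p ∣ ∏ r`.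
[cite: Maynard2016DenseClusters, proof of Lemma 9.3 p. 24, (9.27)–(9.28)] -/
theorem dvd_prod_update_iff {r : Fin k → ℕ} {m : Fin k} (hrm : r m = 1) {c p : ℕ} (hp : p.Prime)
    (hpc : ¬ p ∣ c) : p ∣ ∏ i, Function.update r m c i ↔ p ∣ ∏ i, r i := by
  rw [prod_update_eq_mul hrm c]
  exact ⟨fun hd => ((Nat.Prime.dvd_mul hp).1 hd).resolve_left hpc, fun hd => dvd_mul_of_dvd_right hd c⟩

/-- `X_p = p/(p−1) − 1/(p−ω) > 0` for `2 ≤ p`, `ω < p` (indeed `ω ≤ p − 1`).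
[cite: Maynard2016DenseClusters, proof of Lemma 9.3 p. 24, (9.27)] -/
theorem emFactor_pos {p ω : ℝ} (hp : 2 ≤ p) (hω : ω ≤ p - 1) : 0 < p / (p - 1) - 1 / (p - ω) := by
  have hp1 : 0 < p - 1 := by linarith
  have hpω : 0 < p - ω := by linarith
  rw [div_sub_div _ _ hp1.ne' hpω.ne']
  exact div_pos (by nlinarith) (mul_pos hp1 hpω)

/-- `(p − ω)·X_p = (p − ω)p/(p − 1) − 1` (`= MaynardDense.emA`). [cite: Maynard2016DenseClusters, proof of Lemma 9.3 p. 24, (9.28)–(9.29)] -/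
theorem sub_mul_emFactor_eq {p ω : ℝ} (hpω : p - ω ≠ 0) :
    (p - ω) * (p / (p - 1) - 1 / (p - ω)) = (p - ω) * p / (p - 1) - 1 := by
  rw [mul_sub, mul_div_assoc, mul_one_div, div_self hpω]

/-- The primes of an admissible `c = e_m` (`r[m↦c] ∈ admBox`, `r ∈ 𝒟'^{(m)}_k`): `p ≤ ⌊R⌋`-primorial divisor,
`p ∤ WB`, `p ∤ ∏ r`, `m ∈ admIdx(p)`, and `p ∤ a_m`.
[cite: Maynard2016DenseClusters, proof of Lemma 9.3 p. 24, (9.27) («e_m square-free, (e_m, W B r a_m) = 1»)] -/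
theorem prime_of_dvd_admissible_c {L : Fin k → ℤ × ℤ} (hadm : FormsAdmissible L) {B : ℕ} {R : ℝ}
    {m : Fin k} {r : Fin k → ℕ} (hr : r ∈ dkBoxP L B R m) {c : ℕ}
    (hc : Function.update r m c ∈ admBox L B R) {p : ℕ} (hp : p ∈ c.primeFactors) :
    p.Coprime (wCut k B * B) ∧ ¬ p ∣ ∏ i, r i ∧ m ∈ admIdx L p ∧ ¬ p ∣ (L m).1.natAbs := by
  have hN : primorial ⌊R⌋₊ ≠ 0 := primorial_ne_zero _
  have hrm : r m = 1 := ((mem_dkBoxP_iff).1 hr).2.1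
  have hpp : p.Prime := Nat.prime_of_mem_primeFactors hp
  have hpc : p ∣ c := Nat.dvd_of_mem_primeFactors hp
  rw [admBox_eq] at hc
  obtain ⟨-, hsq, hcop, -⟩ := (mem_admBoxN_iff hN).1 hc
  rw [prod_update_eq_mul hrm c] at hsq hcop
  have hpm : p ∈ (Function.update r m c m).primeFactors := by rwa [Function.update_self]
  have hidx : m ∈ admIdx L p := (dvd_and_mem_admIdx_of_mem_admBoxN hN hc hpm).2
  refine ⟨Nat.Coprime.coprime_dvd_left (hpc.trans (Dvd.intro _ rfl)) hcop, fun hpr => ?_, hidx, fun hpa => ?_⟩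
  · exact (Nat.Prime.coprime_iff_not_dvd hpp).1
      (Nat.Coprime.coprime_dvd_left hpc (Nat.squarefree_mul_iff.1 hsq).1) hpr
  · obtain ⟨n, -, hn, -⟩ := mem_admIdx.1 hidx
    exact not_intDvd_fst_of_dvd_formEval hadm m hpp hn (Int.natCast_dvd.2 hpa)

/-- For a prime of an admissible `c`: `Λ_p(∏ r) = X_p`.
[cite: Maynard2016DenseClusters, proof of Lemma 9.3 p. 24, (9.27)–(9.28)] -/
theorem eulerFactorM_sPrime_of_dvd {L : Fin k → ℤ × ℤ} (hadm : FormsAdmissible L) {B : ℕ} {R : ℝ}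
    {m : Fin k} {r : Fin k → ℕ} (hr : r ∈ dkBoxP L B R m) {c : ℕ}
    (hc : Function.update r m c ∈ admBox L B R) {p : ℕ} (hp : p ∈ c.primeFactors) :
    eulerFactorM L B m (∏ i, r i) (fun p j => sPrimeM L m j p / ((p : ℝ) - omegaL L p)) p =
      (p : ℝ) / ((p : ℝ) - 1) - 1 / ((p : ℝ) - omegaL L p) := by
  have hpp : p.Prime := Nat.prime_of_mem_primeFactors hp
  obtain ⟨hpW, hpr, hidx, hpa⟩ := prime_of_dvd_admissible_c hadm hr hc hp
  have hωlt : omegaL L p < p := ((formsAdmissible_iff_omegaL L).1 hadm).2 p hpp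
  have hpω : ((p : ℝ) - omegaL L p) ≠ 0 := by
    have : (omegaL L p : ℝ) < p := by exact_mod_cast hωlt
    linarith
  have hp1 : ((p : ℝ) - 1) ≠ 0 := by
    have : (1 : ℝ) < p := by exact_mod_cast hpp.one_lt
    linarith
  rw [eulerFactorM_sPrime hadm B m _ hpp, if_pos ⟨hpW, hpr⟩, if_neg hpa, if_pos hidx, zero_div, add_zero,
    one_sub_div_eq_emFactor hp1 hpω]

/-- **The `e_m`-dependence of the Euler product, exactly** (display (9.28)): for `r ∈ 𝒟'^{(m)}_k` and
admissible `c`,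
`(∏_{p ≤ ⌊R⌋} Λ_p(∏ r[m↦c])) / φ_ω(c) = (∏_{p ≤ ⌊R⌋} Λ_p(∏ r)) · (∏_{p ∣ c} (p − ω(p))·X_p)⁻¹`.
[cite: Maynard2016DenseClusters, proof of Lemma 9.3 p. 24, (9.27)–(9.28)] -/
theorem eulerProd_update_div_phiOmega_eq {L : Fin k → ℤ × ℤ} (hadm : FormsAdmissible L) {B : ℕ}
    {R : ℝ} {m : Fin k} {r : Fin k → ℕ} (hr : r ∈ dkBoxP L B R m) {c : ℕ}
    (hc : Function.update r m c ∈ admBox L B R) :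
    (∏ p ∈ (primorial ⌊R⌋₊).primeFactors,
        eulerFactorM L B m (∏ i, Function.update r m c i)
          (fun p j => sPrimeM L m j p / ((p : ℝ) - omegaL L p)) p) / phiOmega L c =
      (∏ p ∈ (primorial ⌊R⌋₊).primeFactors,
          eulerFactorM L B m (∏ i, r i) (fun p j => sPrimeM L m j p / ((p : ℝ) - omegaL L p)) p) *
        (∏ p ∈ c.primeFactors, (((p : ℝ) - omegaL L p) *
          ((p : ℝ) / ((p : ℝ) - 1) - 1 / ((p : ℝ) - omegaL L p))))⁻¹ := by
  classical
  have hN : primorial ⌊R⌋₊ ≠ 0 := primorial_ne_zero _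
  have hrm : r m = 1 := ((mem_dkBoxP_iff).1 hr).2.1
  have hcN : c ∣ primorial ⌊R⌋₊ := by
    have hc' := hc
    rw [admBox_eq] at hc'
    have h := ((mem_admBoxN_iff hN).1 hc').1 m
    rwa [Function.update_self] at h
  have hc0 : c ≠ 0 := fun h => hN (zero_dvd_iff.1 (h ▸ hcN))
  have hcP : c ∣ ∏ i, Function.update r m c i := by
    rw [prod_update_eq_mul hrm c]; exact Dvd.intro _ rfl
  -- the primes of `⌊R⌋#` dividing `c` are the primes of `c`
  have hfilter : (primorial ⌊R⌋₊).primeFactors.filter (fun p => p ∣ c) = c.primeFactors := by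
    ext p
    rw [Finset.mem_filter, Nat.mem_primeFactors, Nat.mem_primeFactors]
    exact ⟨fun ⟨⟨hp, _, _⟩, hpc⟩ => ⟨hp, hpc, hc0⟩, fun ⟨hp, hpc, _⟩ => ⟨⟨hp, hpc.trans hcN, hN⟩, hpc⟩⟩
  -- split both products at `p ∣ c`
  rw [← Finset.prod_filter_mul_prod_filter_not (primorial ⌊R⌋₊).primeFactors (fun p => p ∣ c)
      (fun p => eulerFactorM L B m (∏ i, Function.update r m c i)
        (fun p j => sPrimeM L m j p / ((p : ℝ) - omegaL L p)) p),
    ← Finset.prod_filter_mul_prod_filter_not (primorial ⌊R⌋₊).primeFactors (fun p => p ∣ c)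
      (fun p => eulerFactorM L B m (∏ i, r i) (fun p j => sPrimeM L m j p / ((p : ℝ) - omegaL L p)) p),
    hfilter]
  -- (i) primes of `c`: `Λ_p(∏ r[m↦c]) = 1` and `Λ_p(∏ r) = X_p`
  have h1 : ∏ p ∈ c.primeFactors, eulerFactorM L B m (∏ i, Function.update r m c i)
      (fun p j => sPrimeM L m j p / ((p : ℝ) - omegaL L p)) p = 1 :=
    Finset.prod_eq_one fun p hp =>
      eulerFactorM_of_dvd L B m _ ((Nat.dvd_of_mem_primeFactors hp).trans hcP)
  have h2 : ∏ p ∈ c.primeFactors, eulerFactorM L B m (∏ i, r i)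
      (fun p j => sPrimeM L m j p / ((p : ℝ) - omegaL L p)) p =
      ∏ p ∈ c.primeFactors, ((p : ℝ) / ((p : ℝ) - 1) - 1 / ((p : ℝ) - omegaL L p)) :=
    Finset.prod_congr rfl fun p hp => eulerFactorM_sPrime_of_dvd hadm hr hc hp
  -- (ii) primes not dividing `c`: the factor does not see `c`
  have h3 : ∏ p ∈ (primorial ⌊R⌋₊).primeFactors.filter (fun p => ¬ p ∣ c),
      eulerFactorM L B m (∏ i, Function.update r m c i)
        (fun p j => sPrimeM L m j p / ((p : ℝ) - omegaL L p)) p =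
      ∏ p ∈ (primorial ⌊R⌋₊).primeFactors.filter (fun p => ¬ p ∣ c),
        eulerFactorM L B m (∏ i, r i) (fun p j => sPrimeM L m j p / ((p : ℝ) - omegaL L p)) p :=
    Finset.prod_congr rfl fun p hp => by
      obtain ⟨hpN, hpc⟩ := Finset.mem_filter.1 hp
      exact eulerFactorM_congr_dvd L B m _
        (dvd_prod_update_iff hrm (Nat.prime_of_mem_primeFactors hpN) hpc)
  -- (iii) `X_p ≠ 0` on the primes of `c`
  have hPX : ∏ p ∈ c.primeFactors, ((p : ℝ) / ((p : ℝ) - 1) - 1 / ((p : ℝ) - omegaL L p)) ≠ 0 := by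
    refine Finset.prod_ne_zero_iff.2 fun p hp => ?_
    have hpp : p.Prime := Nat.prime_of_mem_primeFactors hp
    have hωlt : omegaL L p < p := ((formsAdmissible_iff_omegaL L).1 hadm).2 p hpp
    have h2p : (2 : ℝ) ≤ p := by exact_mod_cast hpp.two_le
    have hω : (omegaL L p : ℝ) ≤ (p : ℝ) - 1 := by
      have h : omegaL L p + 1 ≤ p := hωlt
      have h' : ((omegaL L p : ℕ) : ℝ) + 1 ≤ (p : ℝ) := by exact_mod_cast h
      linarith
    exact (emFactor_pos h2p hω).ne'
  have key : ∀ Q Φ PX : ℝ, PX ≠ 0 → Q / Φ = PX * Q * (Φ * PX)⁻¹ := by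
    intro Q Φ PX hPX0
    rw [mul_inv, div_eq_mul_inv]
    calc Q * Φ⁻¹ = Q * Φ⁻¹ * (PX * PX⁻¹) := by rw [mul_inv_cancel₀ hPX0, mul_one]
      _ = PX * Q * (Φ⁻¹ * PX⁻¹) := by ring
  rw [h1, one_mul, h2, h3, Finset.prod_mul_distrib,
    show (∏ p ∈ c.primeFactors, ((p : ℝ) - omegaL L p)) = phiOmega L c from rfl]
  exact key _ _ _ hPX

end FGKMT2018

end Literature.NumberTheory.Sieve
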